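/-
Copyright (c) 2026 the pub-hodgecm-mathlib formalisation cell (harness21).  Prover seat hodgecm-mathlib-LH5-p02 (g3): line LH3 (closer stub `stub_N9`, organ J),
brick (M-UNFOLD) (u2) — CAYLEY-CHART CLAUSES (LH3-plan (g3) deal 2026-09-02T07:54:09Z, RULINGS #8∕#9).
-/
import Literature.NumberTheory.Automorphic.ArchInnerFormSemiregularCentralizerBlockExplicit   -- ★ p850499: the explicit block decomposition ([1]–[10])
import Mathlib.Tactic.Group
import HarnessLib

/-!
# The block decomposition at a semi-regular point read on the CAYLEY chart `insert w₀ S′`: the `B`-component of a split-chart point is the `{0,2}`-block of the boost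
# ((M-UNFOLD) (u2), clauses [5β]∕[6β]; Rogawski 1990 §4.12, §8.2 p. 122; Shelstad 1979 §4; Knapp 1986 V §3)

Topic `NumberTheory/Automorphic`; namespace `Literature.NumberTheory.Automorphic.UnitaryGroup`.  THEOREMS ONLY (no `def`, no instance, no notation, no axiom, no named fact,
no `sorry`).  Cell `pub/hodgecm-mathlib`, crux H413 (`stmt-HodgeConjecture-24833`), F0∕P3c line LH3 (closer stub `stub_N9`, organ J).  ★ p850446∕p850499 decompose
`M′ = Z(gprimeTorus α S′ p) ≃ₜ* B × K` and book-keep the COMPACT chart `S′ ∌ w₀`.  At a REAL wall `p_{w₀,0} = p_{w₀,2}` the same group element is the Cayley point of the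
SPLIT chart `S♯ = insert w₀ S′` (★ `gprimeTorus_of_wall`), so `M′` also centralises every `gprimeTorus α S♯ c`; this file reads the SAME `e` on those points:
* [5β] **the `B`-component of `gprimeTorus α S♯ c` is the 2 × 2 block `(boostStd (formRe α w₀ ∘ τ₀) (c w₀)).submatrix ![0, 2] ![0, 2]`** of the standard boost
  (`E·cosh x`, `E·r·sinh x`; `E·r⁻¹·sinh x`, `E·cosh x` with `x = c_{w₀,0}`, `E = e^{i c_{w₀,2}}`, `r = √(−b₂∕b₀)`, `b = formRe α w₀ ∘ τ₀`) — the token (B-STD)'s `φ : B ≃ₜ* U(J)`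
  (F0P3a-p07, RULINGS #9) sends to `hypBlockGL x θ`;
* [6β] **its `K`-component is `gprimeTorus α S′ (update c w₀ (0, c_{w₀,1}, 0))`** — the same `r₀` as on the compact chart (★ clause [6]), so ONE `r₀` serves both dresses
  (★ `Rogawski1990.ArchChartOrbGBlockReduction` ∕ `…Split`).
Tools: `monomial_one_mul_eq_submatrix_mul` (conjugating by the permutation matrix `M(σ)` re-indexes: `M(σ) · A · M(σ)⁻¹ = A.submatrix σ⁻¹ σ⁻¹`),
`conj_monomialGL_boostStd_eq_gprimeSplitGL` (`e_{τ₀}` carries the standard boost to the split chart component), `gprimeTorus_insert_mem_centralizer`,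
`gprimeBlock_insert_of_ne` (off `w₀` the two charts have the same components).
HONEST LABEL: HC_CM is proved only modulo the 7 printed citations (2 remaining named inputs: hLiu418 = `stmt-HodgeConjecture-24832`, h413 = `stmt-HodgeConjecture-24833`) until
rung 0 closes; count-neutral group-theoretic bookkeeping under organ J of `stub_N9`.

## References
* [Rogawski1990] J. D. Rogawski, *Automorphic Representations of Unitary Groups in Three Variables*, Ann. of Math. Stud. 123 (1990), §8.2 p. 122, §4.12, §3.6 p. 31.
* [Shelstad1979] D. Shelstad, *Characters and inner forms of a quasi-split group over ℝ*, Compositio Math. 39 (1979), §4 pp. 22–25 (Cayley transform at a noncompact wall).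
* [Knapp1986] A. W. Knapp, *Representation Theory of Semisimple Groups* (1986), Ch. V §3.
* [BrockerTomDieck1985] T. Bröcker, T. tom Dieck, *Representations of Compact Lie Groups* (1985), IV (3.2) (permutation matrices re-index).
-/

set_option autoImplicit false

noncomputable section

open NumberField NumberField.InfinitePlace Matrix Complex Topology
open Literature.NumberTheory.Rogawski1990 Literature.LinearAlgebra.Matrix
open scoped MatrixGroups Matrix ComplexConjugate Classical

namespace Literature.NumberTheory.Automorphic.UnitaryGroup

/-! ## §1 Re-indexing by a permutation matrix; the relabelled boost; membership of Cayley-chart points -/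

section Tools

/-- **Conjugating by the permutation matrix re-indexes**: `M(σ) · A = A.submatrix σ⁻¹ σ⁻¹ · M(σ)` for `M(σ) = monomial σ 1` (entries `M(σ)_{i j} = [i = σ j]`).
[cite: BrockerTomDieck1985, IV (3.2)] -/
theorem monomial_one_mul_eq_submatrix_mul {n : Type*} [Fintype n] [DecidableEq n] {R : Type*} [CommRing R] (σ : Equiv.Perm n) (A : Matrix n n R) :
    monomial σ (fun _ => (1 : R)) * A = A.submatrix σ.symm σ.symm * monomial σ (fun _ => (1 : R)) := by
  ext i j
  rw [Matrix.mul_apply, Matrix.mul_apply, Finset.sum_eq_single (σ.symm i), Finset.sum_eq_single (σ j)]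
  · simp only [monomial_apply, Matrix.submatrix_apply, Equiv.apply_symm_apply, Equiv.symm_apply_apply, if_true, one_mul, mul_one]
  · intro k _ hk
    rw [monomial_apply, if_neg hk, mul_zero]
  · intro h; exact absurd (Finset.mem_univ _) h
  · intro k _ hk
    have hne : ¬ i = σ k := fun h => hk (by rw [h, Equiv.symm_apply_apply])
    rw [monomial_apply, if_neg hne, zero_mul]
  · intro h; exact absurd (Finset.mem_univ _) h

/-- `M(σ) · [A] · M(σ)⁻¹ = [A.submatrix σ⁻¹ σ⁻¹]` in `GL_n` (for `det A ≠ 0`). [cite: BrockerTomDieck1985, IV (3.2)] -/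
theorem monomialGL_mul_mkOfDetNeZero_mul_inv {N : ℕ} (σ : Equiv.Perm (Fin N)) (A : Matrix (Fin N) (Fin N) ℂ) (hA : A.det ≠ 0)
    (hA' : (A.submatrix σ.symm σ.symm).det ≠ 0) :
    Matrix.GeneralLinearGroup.mkOfDetNeZero _ (det_monomial_one_ne_zero N σ) * Matrix.GeneralLinearGroup.mkOfDetNeZero A hA *
        (Matrix.GeneralLinearGroup.mkOfDetNeZero _ (det_monomial_one_ne_zero N σ))⁻¹ =
      Matrix.GeneralLinearGroup.mkOfDetNeZero (A.submatrix σ.symm σ.symm) hA' := by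
  rw [mul_inv_eq_iff_eq_mul]
  apply Units.ext
  simp only [Units.val_mul, Matrix.GeneralLinearGroup.val_mkOfDetNeZero]
  exact monomial_one_mul_eq_submatrix_mul σ A

variable (L : Type) [Field L] [NumberField L] [IsCMField L] (α : Fin 3 → L)
  (S' : Finset {w : InfinitePlace L // IsComplex w}) (w₀ : {w : InfinitePlace L // IsComplex w})

omit [NumberField L] [IsCMField L] in
/-- **The relabelling isomorphism carries the standard boost to the split-chart component**: `M(τ₀) · boostStd (a ∘ τ₀) c · M(τ₀)⁻¹ = gprimeSplitGL τ₀ a c` in `GL₃(ℂ)`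
(★ `gprimeSplitMatrix = (boostStd (a ∘ τ) c).submatrix τ⁻¹ τ⁻¹`). [cite: Knapp1986, Ch. V §3] [cite: Rogawski1990, §3.6 p. 31] -/
theorem conj_monomialGL_boostStd_eq_gprimeSplitGL (τ : Fin 3 ≃ Fin 3) (a c : Fin 3 → ℝ) :
    Matrix.GeneralLinearGroup.mkOfDetNeZero _ (det_monomial_one_ne_zero 3 τ) *
        Matrix.GeneralLinearGroup.mkOfDetNeZero (boostStd (a ∘ τ) c) (det_boostStd_ne_zero _ _) *
        (Matrix.GeneralLinearGroup.mkOfDetNeZero _ (det_monomial_one_ne_zero 3 τ))⁻¹ =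
      gprimeSplitGL τ a c := by
  rw [monomialGL_mul_mkOfDetNeZero_mul_inv τ (boostStd (a ∘ τ) c) (det_boostStd_ne_zero _ _) (det_gprimeSplitMatrix_ne_zero τ a c)]
  apply Units.ext
  rw [Matrix.GeneralLinearGroup.val_mkOfDetNeZero, coe_gprimeSplitGL]
  rfl

/-- **Cayley-chart points lie in the centraliser of the wall point**: at a REAL wall `p_{w₀,0} = p_{w₀,2}` of the compact chart `S′ ∌ w₀` (`w₀` a split-chart place),
`gprimeTorus α (insert w₀ S′) c ∈ Z(gprimeTorus α S′ p)` for every `c` (★ `gprimeTorus_of_wall` + ★ `gprimeTorus_mem_centralizer`). [cite: Shelstad1979, §4 p. 25]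
[cite: Rogawski1990, §3.6 p. 31] -/
theorem gprimeTorus_insert_mem_centralizer {S' w₀} (hw₀ : w₀ ∉ S') (hsp : w₀ ∈ splitChartPlaces L α)
    {p : {w : InfinitePlace L // IsComplex w} → Fin 3 → ℝ} (hp : p w₀ 0 = p w₀ 2) (c : {w : InfinitePlace L // IsComplex w} → Fin 3 → ℝ) :
    gprimeTorus L α (insert w₀ S') c ∈
      Subgroup.centralizer ({gprimeTorus L α S' p} : Set ↥(arch (↥(maximalRealSubfield L)) L (IsCMField.complexConj L) 3 (Matrix.diagonal α))) := by
  rw [gprimeTorus_of_wall L α hw₀ hsp hp]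
  exact gprimeTorus_mem_centralizer L α (insert w₀ S') _ c

omit [NumberField L] [IsCMField L] in
/-- **Off `w₀` the charts `S′` and `insert w₀ S′` have the same components.** [cite: Rogawski1990, §3.6 p. 31] -/
theorem gprimeBlock_insert_of_ne {w₀} (c : {w : InfinitePlace L // IsComplex w} → Fin 3 → ℝ) {w : {w : InfinitePlace L // IsComplex w}} (hw : w ≠ w₀) :
    gprimeBlock L α w (insert w₀ S') c = gprimeBlock L α w S' c := by
  apply Subtype.ext
  by_cases hwS : w ∈ S'
  · have hwS' : w ∈ insert w₀ S' := Finset.mem_insert_of_mem hwS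
    by_cases hsp : w ∈ splitChartPlaces L α
    · rw [coe_gprimeBlock_of_mem L α c hwS' hsp, coe_gprimeBlock_of_mem L α c hwS hsp]
    · rw [coe_gprimeBlock_of_not_mem_splitChartPlaces L α c hsp, coe_gprimeBlock_of_not_mem_splitChartPlaces L α c hsp]
  · have hwS' : w ∉ insert w₀ S' := fun h => (Finset.mem_insert.1 h).elim hw hwS
    rw [coe_gprimeBlock_of_not_mem L α c hwS', coe_gprimeBlock_of_not_mem L α c hwS]

end Tools

/-! ## §2 The block decomposition read on the Cayley chart `insert w₀ S′` -/

section Cayley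

variable (L : Type) [Field L] [NumberField L] [IsCMField L] (α : Fin 3 → L)
  (S' : Finset {w : InfinitePlace L // IsComplex w}) (w₀ : {w : InfinitePlace L // IsComplex w})

set_option maxHeartbeats 4000000 in
/-- **(M-UNFOLD) (u2) ON BOTH CHARTS.**  At a REAL wall `p_{w₀,0} = p_{w₀,2}` of the compact chart `S′ ∌ w₀`, `w₀` a split-chart place (so the wall point is the Cayley point of
`S♯ = insert w₀ S′`, ★ `gprimeTorus_of_wall`): the block decomposition `e : M′ ≃ₜ* B × K` of ★ `…_semireg_explicit` (clauses [1]–[10] re-exported VERBATIM) satisfies moreover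
[5β] the `B`-component of `gprimeTorus α S♯ c` is `(boostStd (formRe α w₀ ∘ τ₀) (c w₀)).submatrix ![0, 2] ![0, 2]` (the 2 × 2 boost `(E·cosh x, E·r·sinh x; E·r⁻¹·sinh x, E·cosh x)`,
`x = c_{w₀,0}`, `E = e^{i c_{w₀,2}}`), and [6β] its `K`-component is `gprimeTorus α S′ (update c w₀ (0, c_{w₀,1}, 0))`.
[cite: Rogawski1990, §8.2 p. 122; §4.12; §3.6 p. 31] [cite: Shelstad1979, §4 pp. 22–25] [cite: Knapp1986, Ch. V §3] -/
theorem exists_continuousMulEquiv_centralizer_gprimeTorus_semireg_cayley (hα : ∀ i, α i ≠ 0) (hS' : ∀ w, w ∈ S' → w ∈ splitChartPlaces L α)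
    (hw₀ : w₀ ∉ S') (hsp : w₀ ∈ splitChartPlaces L α) (p : {w : InfinitePlace L // IsComplex w} → Fin 3 → ℝ) (hp : p w₀ 0 = p w₀ 2)
    (h01 : Circle.exp (p w₀ 0) ≠ Circle.exp (p w₀ 1))
    (hreg : ∀ w, w ≠ w₀ → w ∉ S' → Function.Injective fun i : Fin 3 => Circle.exp (p w i)) (hregS : ∀ w, w ∈ S' → p w 0 ≠ 0) :
    ∃ (K : Subgroup ↥(Subgroup.centralizer ({gprimeTorus L α S' p} : Set ↥(arch (↥(maximalRealSubfield L)) L (IsCMField.complexConj L) 3 (Matrix.diagonal α)))))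
      (e : ↥(Subgroup.centralizer ({gprimeTorus L α S' p} : Set ↥(arch (↥(maximalRealSubfield L)) L (IsCMField.complexConj L) 3 (Matrix.diagonal α)))) ≃ₜ*
        ↥(unitaryGroupOfForm (starRingEnd ℂ) ((Matrix.diagonal ![α (lineOf (formSign L α w₀) 0), α (lineOf (formSign L α w₀) 2)]).map w₀.1.embedding)) × ↥K),
      IsClosed (K : Set ↥(Subgroup.centralizer ({gprimeTorus L α S' p} : Set ↥(arch (↥(maximalRealSubfield L)) L (IsCMField.complexConj L) 3 (Matrix.diagonal α))))) ∧
      (∀ k : ↥(Subgroup.centralizer ({gprimeTorus L α S' p} : Set ↥(arch (↥(maximalRealSubfield L)) L (IsCMField.complexConj L) 3 (Matrix.diagonal α)))),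
        k ∈ K → (k : ↥(arch (↥(maximalRealSubfield L)) L (IsCMField.complexConj L) 3 (Matrix.diagonal α))) ∈ chartTorusG L α S') ∧
      (∀ k₁, k₁ ∈ K → ∀ k₂, k₂ ∈ K → k₁ * k₂ = k₂ * k₁) ∧
      (∀ g : ↥(Subgroup.centralizer ({gprimeTorus L α S' p} : Set ↥(arch (↥(maximalRealSubfield L)) L (IsCMField.complexConj L) 3 (Matrix.diagonal α)))),
        (g : ↥(arch (↥(maximalRealSubfield L)) L (IsCMField.complexConj L) 3 (Matrix.diagonal α))) ∈ chartTorusG L α S' ↔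
        (((e g).1 : ↥(unitaryGroupOfForm (starRingEnd ℂ) ((Matrix.diagonal ![α (lineOf (formSign L α w₀) 0), α (lineOf (formSign L α w₀) 2)]).map w₀.1.embedding))) :
          GL (Fin 2) ℂ) ∈ Set.range (circleDiagonal 2)) ∧
      (∀ c : {w : InfinitePlace L // IsComplex w} → Fin 3 → ℝ,
        (((e ⟨gprimeTorus L α S' c, gprimeTorus_mem_centralizer L α S' p c⟩).1 :
          ↥(unitaryGroupOfForm (starRingEnd ℂ) ((Matrix.diagonal ![α (lineOf (formSign L α w₀) 0), α (lineOf (formSign L α w₀) 2)]).map w₀.1.embedding))) : GL (Fin 2) ℂ) =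
          circleDiagonal 2 ![Circle.exp (c w₀ 0), Circle.exp (c w₀ 2)]) ∧
      (∀ c : {w : InfinitePlace L // IsComplex w} → Fin 3 → ℝ,
        ((((e ⟨gprimeTorus L α S' c, gprimeTorus_mem_centralizer L α S' p c⟩).2 : ↥K) :
          ↥(Subgroup.centralizer ({gprimeTorus L α S' p} : Set ↥(arch (↥(maximalRealSubfield L)) L (IsCMField.complexConj L) 3 (Matrix.diagonal α))))) :
            ↥(arch (↥(maximalRealSubfield L)) L (IsCMField.complexConj L) 3 (Matrix.diagonal α))) =
          gprimeTorus L α S' (Function.update c w₀ ![0, c w₀ 1, 0])) ∧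
      Subgroup.map (e : ↥(Subgroup.centralizer ({gprimeTorus L α S' p} : Set ↥(arch (↥(maximalRealSubfield L)) L (IsCMField.complexConj L) 3 (Matrix.diagonal α)))) →*
          ↥(unitaryGroupOfForm (starRingEnd ℂ) ((Matrix.diagonal ![α (lineOf (formSign L α w₀) 0), α (lineOf (formSign L α w₀) 2)]).map w₀.1.embedding)) × ↥K)
        ((chartTorusG L α S').subgroupOf (Subgroup.centralizer ({gprimeTorus L α S' p} : Set ↥(arch (↥(maximalRealSubfield L)) L (IsCMField.complexConj L) 3 (Matrix.diagonal α))))) =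
        (((circleDiagonal 2).codRestrict (unitaryGroupOfForm (starRingEnd ℂ) ((Matrix.diagonal ![α (lineOf (formSign L α w₀) 0), α (lineOf (formSign L α w₀) 2)]).map w₀.1.embedding))
            (circleDiagonal_mem_archLocal_diagonal L 2 ![α (lineOf (formSign L α w₀) 0), α (lineOf (formSign L α w₀) 2)] w₀)).range).prod ⊤ ∧
      -- [8] the inverse on `B × 1` is the block embedding through ★ `archPiEquivCM`, the relabelling `e_{τ₀}` and ★ `endoEmb`
      (∀ b : ↥(unitaryGroupOfForm (starRingEnd ℂ) ((Matrix.diagonal ![α (lineOf (formSign L α w₀) 0), α (lineOf (formSign L α w₀) 2)]).map w₀.1.embedding)),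
        ((e.symm (b, 1) : ↥(Subgroup.centralizer ({gprimeTorus L α S' p} : Set ↥(arch (↥(maximalRealSubfield L)) L (IsCMField.complexConj L) 3 (Matrix.diagonal α))))) : ↥(arch (↥(maximalRealSubfield L)) L (IsCMField.complexConj L) 3 (Matrix.diagonal α))) =
          (archPiEquivCM 3 L (Matrix.diagonal α)).symm (Pi.mulSingle w₀
            ((ContinuousMulEquiv.restrictSubgroup
            (GLn.conjEquiv (Matrix.GeneralLinearGroup.mkOfDetNeZero _ (det_monomial_one_ne_zero 3 (lineOf (formSign L α w₀)))))
            (archLocal L 3 (Matrix.diagonal (α ∘ (lineOf (formSign L α w₀)))) w₀) (archLocal L 3 (Matrix.diagonal α) w₀)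
            (mem_archLocal_comp_perm_iff_conj_mem L 3 α w₀ (lineOf (formSign L α w₀))))
              ((endoEmb (starRingEnd ℂ) ((Matrix.diagonal ![(α ∘ (lineOf (formSign L α w₀))) 0, (α ∘ (lineOf (formSign L α w₀))) 2]).map w₀.1.embedding)
              ((Matrix.diagonal ![(α ∘ (lineOf (formSign L α w₀))) 1]).map w₀.1.embedding) ((Matrix.diagonal (α ∘ (lineOf (formSign L α w₀)))).map w₀.1.embedding)
              (endoForm_archLocal_diagonal L (α ∘ (lineOf (formSign L α w₀))) w₀)) (b, 1))))) ∧
      -- [9] the `w₀`-component of `g ∈ M′` is the block embedding of `((e g).1, u)` for some `u ∈ U(σ_{w₀} α (τ₀ 1))(ℂ)`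
      (∀ g : ↥(Subgroup.centralizer ({gprimeTorus L α S' p} : Set ↥(arch (↥(maximalRealSubfield L)) L (IsCMField.complexConj L) 3 (Matrix.diagonal α)))), ∃ u : ↥(unitaryGroupOfForm (starRingEnd ℂ) ((Matrix.diagonal ![(α ∘ (lineOf (formSign L α w₀))) 1]).map w₀.1.embedding)),
        archPiEquivCM 3 L (Matrix.diagonal α) (g : ↥(arch (↥(maximalRealSubfield L)) L (IsCMField.complexConj L) 3 (Matrix.diagonal α))) w₀ =
          (ContinuousMulEquiv.restrictSubgroup
            (GLn.conjEquiv (Matrix.GeneralLinearGroup.mkOfDetNeZero _ (det_monomial_one_ne_zero 3 (lineOf (formSign L α w₀)))))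
            (archLocal L 3 (Matrix.diagonal (α ∘ (lineOf (formSign L α w₀)))) w₀) (archLocal L 3 (Matrix.diagonal α) w₀)
            (mem_archLocal_comp_perm_iff_conj_mem L 3 α w₀ (lineOf (formSign L α w₀))))
            ((endoEmb (starRingEnd ℂ) ((Matrix.diagonal ![(α ∘ (lineOf (formSign L α w₀))) 0, (α ∘ (lineOf (formSign L α w₀))) 2]).map w₀.1.embedding)
              ((Matrix.diagonal ![(α ∘ (lineOf (formSign L α w₀))) 1]).map w₀.1.embedding) ((Matrix.diagonal (α ∘ (lineOf (formSign L α w₀)))).map w₀.1.embedding)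
              (endoForm_archLocal_diagonal L (α ∘ (lineOf (formSign L α w₀))) w₀)) ((e g).1, u))) ∧
      -- [10] `e` is the identity on `K`
      (∀ k : ↥(Subgroup.centralizer ({gprimeTorus L α S' p} : Set ↥(arch (↥(maximalRealSubfield L)) L (IsCMField.complexConj L) 3 (Matrix.diagonal α)))), ∀ hk : k ∈ K, e k = (1, ⟨k, hk⟩)) ∧
      -- [5β] the `B`-component of a CAYLEY-chart point is the `{0,2}`-block of the standard boost
      (∀ c : {w : InfinitePlace L // IsComplex w} → Fin 3 → ℝ,
        ((((e ⟨gprimeTorus L α (insert w₀ S') c, gprimeTorus_insert_mem_centralizer L α hw₀ hsp hp c⟩).1 : ↥(unitaryGroupOfForm (starRingEnd ℂ) ((Matrix.diagonal ![α (lineOf (formSign L α w₀) 0), α (lineOf (formSign L α w₀) 2)]).map w₀.1.embedding))) :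
            GL (Fin 2) ℂ) : Matrix (Fin 2) (Fin 2) ℂ) =
          (boostStd (formRe L α w₀ ∘ (lineOf (formSign L α w₀))) (c w₀)).submatrix ![0, 2] ![0, 2]) ∧
      -- [6β] its `K`-component is the same `r₀`-type chart point as on the compact chart
      (∀ c : {w : InfinitePlace L // IsComplex w} → Fin 3 → ℝ,
        ((((e ⟨gprimeTorus L α (insert w₀ S') c, gprimeTorus_insert_mem_centralizer L α hw₀ hsp hp c⟩).2 : ↥K) : ↥(Subgroup.centralizer ({gprimeTorus L α S' p} : Set ↥(arch (↥(maximalRealSubfield L)) L (IsCMField.complexConj L) 3 (Matrix.diagonal α))))) : ↥(arch (↥(maximalRealSubfield L)) L (IsCMField.complexConj L) 3 (Matrix.diagonal α))) =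
          gprimeTorus L α S' (Function.update c w₀ ![0, c w₀ 1, 0])) := by
  classical
  have h02 : Circle.exp (p w₀ 0) = Circle.exp (p w₀ 2) := by rw [hp]
  -- abbreviations (the statement-level terms, named) — BEFORE destructuring, so that every hypothesis is born in this spelling
  set τ₀ : Fin 3 ≃ Fin 3 := lineOf (formSign L α w₀) with hτ₀
  set REL := (ContinuousMulEquiv.restrictSubgroup
            (GLn.conjEquiv (Matrix.GeneralLinearGroup.mkOfDetNeZero _ (det_monomial_one_ne_zero 3 (lineOf (formSign L α w₀)))))
            (archLocal L 3 (Matrix.diagonal (α ∘ (lineOf (formSign L α w₀)))) w₀) (archLocal L 3 (Matrix.diagonal α) w₀)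
            (mem_archLocal_comp_perm_iff_conj_mem L 3 α w₀ (lineOf (formSign L α w₀)))) with hREL
  set ENDO := (endoEmb (starRingEnd ℂ) ((Matrix.diagonal ![(α ∘ (lineOf (formSign L α w₀))) 0, (α ∘ (lineOf (formSign L α w₀))) 2]).map w₀.1.embedding)
              ((Matrix.diagonal ![(α ∘ (lineOf (formSign L α w₀))) 1]).map w₀.1.embedding) ((Matrix.diagonal (α ∘ (lineOf (formSign L α w₀)))).map w₀.1.embedding)
              (endoForm_archLocal_diagonal L (α ∘ (lineOf (formSign L α w₀))) w₀)) with hENDO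
  let G := ↥(arch (↥(maximalRealSubfield L)) L (IsCMField.complexConj L) 3 (Matrix.diagonal α))
  let M' : Subgroup G := Subgroup.centralizer ({gprimeTorus L α S' p} : Set ↥(arch (↥(maximalRealSubfield L)) L (IsCMField.complexConj L) 3 (Matrix.diagonal α)))
  let Mτ : GL (Fin 3) ℂ := Matrix.GeneralLinearGroup.mkOfDetNeZero _ (det_monomial_one_ne_zero 3 τ₀)
  obtain ⟨K, e, h1, h2, h3, h4, h5, h6, h7, h8, h9, h10⟩ :=
    exists_continuousMulEquiv_centralizer_gprimeTorus_semireg_explicit L α S' w₀ hα hS' hw₀ p h02 h01 hreg hregS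
  -- §A the core computation at `w₀` for a Cayley-chart point
  have hcore : ∀ c : {w : InfinitePlace L // IsComplex w} → Fin 3 → ℝ, ∃ u : ↥(unitaryGroupOfForm (starRingEnd ℂ) ((Matrix.diagonal ![(α ∘ (lineOf (formSign L α w₀))) 1]).map w₀.1.embedding)),
      archPiEquivCM 3 L (Matrix.diagonal α) (gprimeTorus L α (insert w₀ S') c) w₀ =
        REL (ENDO ((e ⟨gprimeTorus L α (insert w₀ S') c, gprimeTorus_insert_mem_centralizer L α hw₀ hsp hp c⟩).1, u)) ∧
      endoGL ((((e ⟨gprimeTorus L α (insert w₀ S') c, gprimeTorus_insert_mem_centralizer L α hw₀ hsp hp c⟩).1 : ↥(unitaryGroupOfForm (starRingEnd ℂ) ((Matrix.diagonal ![α (lineOf (formSign L α w₀) 0), α (lineOf (formSign L α w₀) 2)]).map w₀.1.embedding))) : GL (Fin 2) ℂ),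
          ((u : ↥(unitaryGroupOfForm (starRingEnd ℂ) ((Matrix.diagonal ![(α ∘ (lineOf (formSign L α w₀))) 1]).map w₀.1.embedding))) : GL (Fin 1) ℂ)) =
        Matrix.GeneralLinearGroup.mkOfDetNeZero (boostStd (formRe L α w₀ ∘ τ₀) (c w₀)) (det_boostStd_ne_zero _ _) := by
    intro c
    obtain ⟨u, hu⟩ := h9 ⟨gprimeTorus L α (insert w₀ S') c, gprimeTorus_insert_mem_centralizer L α hw₀ hsp hp c⟩
    refine ⟨u, hu, ?_⟩
    have hL : ((archPiEquivCM 3 L (Matrix.diagonal α) (gprimeTorus L α (insert w₀ S') c) w₀ : ↥(archLocal L 3 (Matrix.diagonal α) w₀)) : GL (Fin 3) ℂ) =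
        gprimeSplitGL τ₀ (formRe L α w₀) (c w₀) := by
      rw [archPiEquivCM_gprimeTorus]
      exact coe_gprimeBlock_of_mem L α c (Finset.mem_insert_self w₀ S') hsp
    have hGL := congrArg (fun y : ↥(archLocal L 3 (Matrix.diagonal α) w₀) => (y : GL (Fin 3) ℂ)) hu
    rw [hL] at hGL
    -- `hGL : gprimeSplitGL … = M(τ₀) · endoGL (b, u) · M(τ₀)⁻¹` (the relabelling iso is conjugation by `M(τ₀)`, definitionally)
    have key : Mτ * endoGL ((((e ⟨gprimeTorus L α (insert w₀ S') c, gprimeTorus_insert_mem_centralizer L α hw₀ hsp hp c⟩).1 : ↥(unitaryGroupOfForm (starRingEnd ℂ) ((Matrix.diagonal ![α (lineOf (formSign L α w₀) 0), α (lineOf (formSign L α w₀) 2)]).map w₀.1.embedding))) : GL (Fin 2) ℂ),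
        ((u : ↥(unitaryGroupOfForm (starRingEnd ℂ) ((Matrix.diagonal ![(α ∘ (lineOf (formSign L α w₀))) 1]).map w₀.1.embedding))) : GL (Fin 1) ℂ)) * Mτ⁻¹ =
        Mτ * Matrix.GeneralLinearGroup.mkOfDetNeZero (boostStd (formRe L α w₀ ∘ τ₀) (c w₀)) (det_boostStd_ne_zero _ _) * Mτ⁻¹ := by
      rw [conj_monomialGL_boostStd_eq_gprimeSplitGL τ₀ (formRe L α w₀) (c w₀)]
      exact hGL.symm
    exact mul_left_cancel (mul_right_cancel key)
  refine ⟨K, e, h1, h2, h3, h4, h5, h6, h7, h8, h9, h10, ?_, ?_⟩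
  · -- [5β]
    intro c
    obtain ⟨u, -, hX⟩ := hcore c
    have hmat := congrArg (fun g : GL (Fin 3) ℂ => (g : Matrix (Fin 3) (Fin 3) ℂ)) hX
    rw [coe_endoGL_eq, Matrix.GeneralLinearGroup.val_mkOfDetNeZero] at hmat
    ext i j
    fin_cases i <;> fin_cases j
    · exact congrFun (congrFun hmat 0) 0
    · exact congrFun (congrFun hmat 0) 2
    · exact congrFun (congrFun hmat 2) 0
    · exact congrFun (congrFun hmat 2) 2
  · -- [6β]
    intro c
    obtain ⟨u, hu, hX⟩ := hcore c
    have hmat := congrArg (fun g : GL (Fin 3) ℂ => (g : Matrix (Fin 3) (Fin 3) ℂ)) hX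
    rw [coe_endoGL_eq, Matrix.GeneralLinearGroup.val_mkOfDetNeZero] at hmat
    have hu11 : (((u : ↥(unitaryGroupOfForm (starRingEnd ℂ) ((Matrix.diagonal ![(α ∘ (lineOf (formSign L α w₀))) 1]).map w₀.1.embedding))) : GL (Fin 1) ℂ) : Matrix (Fin 1) (Fin 1) ℂ) 0 0 = Complex.exp (((c w₀ 1 : ℝ) : ℂ) * I) :=
      congrFun (congrFun hmat 1) 1
    -- the `K`-component as an element of `M′`: `k = (e⁻¹ (b, 1))⁻¹ · γ`
    have hkM : ((((e ⟨gprimeTorus L α (insert w₀ S') c, gprimeTorus_insert_mem_centralizer L α hw₀ hsp hp c⟩).2 : ↥K) : ↥M')) =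
        (e.symm ((e ⟨gprimeTorus L α (insert w₀ S') c, gprimeTorus_insert_mem_centralizer L α hw₀ hsp hp c⟩).1, 1))⁻¹ *
          ⟨gprimeTorus L α (insert w₀ S') c, gprimeTorus_insert_mem_centralizer L α hw₀ hsp hp c⟩ := by
      set γ : ↥M' := ⟨gprimeTorus L α (insert w₀ S') c, gprimeTorus_insert_mem_centralizer L α hw₀ hsp hp c⟩ with hγ
      rw [eq_inv_mul_iff_mul_eq]
      have hk1 : e.symm (1, (e γ).2) = (((e γ).2 : ↥K) : ↥M') := by
        have h := h10 (((e γ).2 : ↥K) : ↥M') ((e γ).2).2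
        rw [Subtype.coe_eta] at h
        rw [← h, e.symm_apply_apply]
      calc e.symm ((e γ).1, 1) * (((e γ).2 : ↥K) : ↥M') = e.symm ((e γ).1, 1) * e.symm (1, (e γ).2) := by rw [hk1]
        _ = e.symm (((e γ).1, 1) * (1, (e γ).2)) := (map_mul e.symm _ _).symm
        _ = e.symm (e γ) := by rw [Prod.mk_mul_mk, mul_one, one_mul]
        _ = γ := e.symm_apply_apply γ
    have hG : (((((e ⟨gprimeTorus L α (insert w₀ S') c, gprimeTorus_insert_mem_centralizer L α hw₀ hsp hp c⟩).2 : ↥K) : ↥M')) : G) =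
        (((e.symm ((e ⟨gprimeTorus L α (insert w₀ S') c, gprimeTorus_insert_mem_centralizer L α hw₀ hsp hp c⟩).1, 1)) : ↥M') : G)⁻¹ *
          gprimeTorus L α (insert w₀ S') c := by
      rw [hkM, Subgroup.coe_mul, Subgroup.coe_inv]
    rw [hG, h8]
    apply (archPiEquivCM 3 L (Matrix.diagonal α)).injective
    funext w
    rw [map_mul, map_inv, Pi.mul_apply, Pi.inv_apply, ContinuousMulEquiv.apply_symm_apply]
    by_cases hw : w = w₀
    · rw [hw, Pi.mulSingle_eq_same]
      -- compare in `GL₃(ℂ)`: conjugation by `M(τ₀)` on both sides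
      apply Subtype.ext
      rw [Subgroup.coe_mul, Subgroup.coe_inv]
      have hRel : ((REL (ENDO ((e ⟨gprimeTorus L α (insert w₀ S') c, gprimeTorus_insert_mem_centralizer L α hw₀ hsp hp c⟩).1, 1)) :
            ↥(archLocal L 3 (Matrix.diagonal α) w₀)) : GL (Fin 3) ℂ) =
          Mτ * endoGL ((((e ⟨gprimeTorus L α (insert w₀ S') c, gprimeTorus_insert_mem_centralizer L α hw₀ hsp hp c⟩).1 : ↥(unitaryGroupOfForm (starRingEnd ℂ) ((Matrix.diagonal ![α (lineOf (formSign L α w₀) 0), α (lineOf (formSign L α w₀) 2)]).map w₀.1.embedding))) :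
            GL (Fin 2) ℂ), 1) * Mτ⁻¹ := rfl
      have hΦc : ((archPiEquivCM 3 L (Matrix.diagonal α) (gprimeTorus L α (insert w₀ S') c) w₀ : ↥(archLocal L 3 (Matrix.diagonal α) w₀)) : GL (Fin 3) ℂ) =
          Mτ * Matrix.GeneralLinearGroup.mkOfDetNeZero (boostStd (formRe L α w₀ ∘ τ₀) (c w₀)) (det_boostStd_ne_zero _ _) * Mτ⁻¹ := by
        rw [archPiEquivCM_gprimeTorus, coe_gprimeBlock_of_mem L α c (Finset.mem_insert_self w₀ S') hsp, conj_monomialGL_boostStd_eq_gprimeSplitGL]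
      have hupd : ((archPiEquivCM 3 L (Matrix.diagonal α) (gprimeTorus L α S' (Function.update c w₀ ![0, c w₀ 1, 0])) w₀ :
            ↥(archLocal L 3 (Matrix.diagonal α) w₀)) : GL (Fin 3) ℂ) =
          Mτ * circleDiagonal 3 (fun k => Circle.exp ((![0, c w₀ 1, 0] : Fin 3 → ℝ) k)) * Mτ⁻¹ := by
        rw [archPiEquivCM_gprimeTorus, coe_gprimeBlock_of_not_mem L α _ hw₀, monomial_conj_circleDiagonal, Function.update_self]
        rfl
      rw [hRel, hΦc, hupd, ← hX]
      have hgrp : ∀ X Y : GL (Fin 3) ℂ, (Mτ * X * Mτ⁻¹)⁻¹ * (Mτ * Y * Mτ⁻¹) = Mτ * (X⁻¹ * Y) * Mτ⁻¹ := fun X Y => by group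
      rw [hgrp, ← map_inv, ← map_mul, Prod.inv_mk, inv_one, Prod.mk_mul_mk, inv_mul_cancel, one_mul]
      congr 1; congr 1
      -- `endoGL (1, u) = diag(1, e^{i c_{w₀,1}}, 1)`
      apply Units.ext
      rw [coe_endoGL_eq, coe_circleDiagonal]
      ext i j
      fin_cases i <;> fin_cases j <;>
        simp [hu11, Matrix.diagonal, Circle.coe_exp, Units.val_one]
    · rw [Pi.mulSingle_eq_of_ne hw, inv_one, one_mul, archPiEquivCM_gprimeTorus, archPiEquivCM_gprimeTorus, gprimeBlock_insert_of_ne L α S' c hw]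
      exact gprimeBlock_congr_place L α S' w (Function.update_of_ne hw _ c).symm

end Cayley

end Literature.NumberTheory.Automorphic.UnitaryGroup

end
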